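import Mathlib
import Summits.NavierStokesRegularity.NavierStokesRegularity.Theorems.EulerZoomLiouvillePowerGaugeEulerLiouvilleWeakVorticityMollified
import Summits.NavierStokesRegularity.NavierStokesRegularity.Theorems.EulerZoomLiouvillePowerGaugeEulerLiouvilleWeakCasimirMass
import Literature.Analysis.FunctionSpaces.SobolevGradCommutatorLocal
import Literature.Analysis.FunctionSpaces.ContDiffBumpRescale
import HarnessLib

/-!
# Crux `EulerZoomLiouville.PowerGaugeEulerLiouville` (stmt-NavierStokesRegularity-19832), weak stratum, line `weak_eulerian` (E2):
# THE VECTOR COMMUTATOR OF THE MOLLIFIED WEAK VORTICITY EQUATION TENDS TO ZERO IN `L¹_loc`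

Route №10 `EulerZoomLiouville` (NavierStokesRegularity), crux E = stmt-NavierStokesRegularity-19832; width seat ns-ezl-w2 g7 under the LEAD ns-typeII-p2.
Third brick of `stub_renormalisation` (E2).  CLASS-FREE SETTING: `Θ ∈ L²_loc(ℝ³; ℝ³)` (the vorticity), `W ∈ L²_loc` with a whole-space weak
gradient `DW ∈ L²_loc` and `tr DW = c` a.e. (`div W = c`), a source `S ∈ L¹_loc`, and the componentwise weak transport equation
`∫ ⟪Θ, e⟫ Dψ[W] = ∫ ψ ⟪S, e⟫` for all tests `ψ` and all `e` (`div(W ⊗ Θ) = −S`).  For a FIXED-SHAPE bump sequence `φₙ` (`rOut = 2·rIn → 0`)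
put `Θₙ = φ̃ₙ ⋆ Θ`, `Sₙ = φ̃ₙ ⋆ S` and define the VECTOR COMMUTATOR

  `sₙ(y) := DΘₙ(y)[W y] + c Θₙ(y) + Sₙ(y)`.

* `inner_commutatorVec_eq` — its components are the DiPerna–Lions commutators of the components:
  `⟪sₙ(y), e⟫ = ∫ ⟪Θ z, e⟫ Dφ̃ₙ(y−z)[W y − W z] dz + (φ̃ₙ ⋆ (⟪Θ, e⟫·tr DW))(y)` (component identity of `…WeakVorticityMollified`,
  `tr DW = c` a.e.);
* `tendsto_setLIntegral_inner_commutatorVec` — hence `∫_{B_R} |⟪sₙ, e⟫| → 0` by THE DIPERNA–LIONS COMMUTATOR LEMMA in its tree form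
  `Literature.Analysis.FunctionSpaces.tendsto_setLIntegral_gradCommutator'` (p708958, over `tendsto_lintegral_gradCommutator` p708396); the uniform
  first-moment bound of a fixed-shape sequence comes from `integral_norm_mul_norm_gradient_normed_bumpRescale` (a bump with `rOut = 2·rIn` IS
  `bumpRescale ⟨1,2⟩ (rIn⁻¹)`, `eq_bumpRescale_of_shape`) — the same two facts as `Literature…DiPernaLionsCommutatorL2_holds` (p709665), re-derived
  here in three lines so that this file does not import that module;
* `tendsto_setLIntegral_commutatorVec` — and `∫_{B_R} ‖sₙ‖ → 0` (`‖v‖ ≤ Σᵢ |⟪v, bᵢ⟫|` over the standard basis).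
Plus data plumbing (`exists_fixedShape_bumpSeq`, measurability / local integrability of the pieces).
[folklore; DiPernaLions1989 §II.1 (proof of Thm. II.1), Lemma II.1]

WHAT THIS IS NOT: not NS, not E, not E2 yet (the renormalisation limit is the next file); 19832 is OPEN.
-/

noncomputable section

-- flat `Theorems/<Route><Decl>…` files of one crux share the namespace of the crux (tree convention)
set_option linter.dupNamespace false

open MeasureTheory Set Filter Topology Metric Function TopologicalSpace ContinuousLinearMap
open scoped ENNReal NNReal RealInnerProductSpace ContDiff Convolution

namespace Summit.NavierStokesRegularity.NavierStokesRegularity.Theorems.PowerGaugeEulerLiouville.WeakEulerian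

open Literature.Analysis Literature.Analysis.FunctionSpaces Literature.Analysis.FluidPDE
open Summit.NavierStokesRegularity.NavierStokesRegularity.Theorems.PowerGaugeEulerLiouville

/-! ### Tools -/

section Tools

/-- `ℓ² ≤ ℓ¹` on `ℝ³`: `‖v‖ ≤ Σᵢ |⟪v, bᵢ⟫|` for the standard orthonormal basis `b`. [folklore] -/
theorem norm_le_sum_abs_inner_basisFun (v : EuclideanSpace ℝ (Fin 3)) :
    ‖v‖ ≤ ∑ i, |⟪v, EuclideanSpace.basisFun (Fin 3) ℝ i⟫| := by
  set b := EuclideanSpace.basisFun (Fin 3) ℝ with hb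
  have hv : v = ∑ i, ⟪(b i : EuclideanSpace ℝ (Fin 3)), v⟫ • (b i : EuclideanSpace ℝ (Fin 3)) := (b.sum_repr' v).symm
  calc ‖v‖ = ‖∑ i, ⟪(b i : EuclideanSpace ℝ (Fin 3)), v⟫ • (b i : EuclideanSpace ℝ (Fin 3))‖ := by rw [← hv]
    _ ≤ ∑ i, ‖⟪(b i : EuclideanSpace ℝ (Fin 3)), v⟫ • (b i : EuclideanSpace ℝ (Fin 3))‖ := norm_sum_le _ _
    _ = ∑ i, |⟪v, b i⟫| := by
        refine Finset.sum_congr rfl fun i _ => ?_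
        rw [norm_smul, b.orthonormal.1 i, mul_one, Real.norm_eq_abs, real_inner_comm]

/-- `‖v‖ₑ ≤ Σᵢ ‖⟪v, bᵢ⟫‖ₑ` (the same in `ℝ≥0∞`). [folklore] -/
theorem enorm_le_sum_enorm_inner_basisFun (v : EuclideanSpace ℝ (Fin 3)) :
    ‖v‖ₑ ≤ ∑ i, ‖⟪v, EuclideanSpace.basisFun (Fin 3) ℝ i⟫‖ₑ := by
  have h := norm_le_sum_abs_inner_basisFun v
  rw [← ofReal_norm, ← Finset.sum_congr rfl fun i _ => (ofReal_norm (⟪v, EuclideanSpace.basisFun (Fin 3) ℝ i⟫)),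
    ← ENNReal.ofReal_sum_of_nonneg fun i _ => norm_nonneg _]
  exact ENNReal.ofReal_le_ofReal (by simpa only [Real.norm_eq_abs] using h)

/-- **A fixed-shape bump sequence**: bumps `φₙ` centred at `0` with `rOut(φₙ) = 2·rIn(φₙ) = 2/(n+1) → 0`. [folklore] -/
theorem exists_fixedShape_bumpSeq :
    ∃ φ : ℕ → ContDiffBump (0 : EuclideanSpace ℝ (Fin 3)),
      Tendsto (fun n => (φ n).rOut) atTop (𝓝 0) ∧ ∀ n, (φ n).rOut = 2 * (φ n).rIn := by
  refine ⟨fun n => ⟨((n : ℝ) + 1)⁻¹, 2 * ((n : ℝ) + 1)⁻¹, by positivity, by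
    have : (0 : ℝ) < ((n : ℝ) + 1)⁻¹ := by positivity
    linarith⟩, ?_, fun n => rfl⟩
  have h : Tendsto (fun n : ℕ => 2 * ((n : ℝ) + 1)⁻¹) atTop (𝓝 (2 * 0)) :=
    (tendsto_one_div_add_atTop_nhds_zero_nat.congr fun n => by rw [one_div]).const_mul 2
  rw [mul_zero] at h
  exact h

/-- Two bumps with the same centre and radii coincide. [folklore] -/
theorem contDiffBump_eq_of_radii {E : Type*} {c : E} {f g : ContDiffBump c} (h1 : f.rIn = g.rIn) (h2 : f.rOut = g.rOut) :
    f = g := by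
  cases f; cases g; simp only at h1 h2; subst h1; subst h2; rfl

/-- A fixed-shape bump (`rOut = 2·rIn`) is the rescaling `bumpRescale ⟨1, 2⟩ (rIn⁻¹)` of the reference bump. [folklore] -/
theorem eq_bumpRescale_of_shape (φ : ContDiffBump (0 : EuclideanSpace ℝ (Fin 3))) (h : φ.rOut = 2 * φ.rIn) :
    φ = bumpRescale (⟨1, 2, one_pos, one_lt_two⟩ : ContDiffBump (0 : EuclideanSpace ℝ (Fin 3))) (inv_pos.2 φ.rIn_pos) := by
  refine contDiffBump_eq_of_radii ?_ ?_
  · rw [bumpRescale_rIn, one_div, inv_inv]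
  · rw [bumpRescale_rOut, h, div_eq_mul_inv, inv_inv]

/-- Hence the first gradient moments of a fixed-shape sequence are CONSTANT (`= ∫‖z‖‖∇φ̃₀‖` for the reference bump `φ₀ = ⟨1,2⟩`). [folklore] -/
theorem integral_moment_eq_of_shape (φ : ContDiffBump (0 : EuclideanSpace ℝ (Fin 3))) (h : φ.rOut = 2 * φ.rIn) :
    ∫ z, ‖z‖ * ‖gradient (φ.normed volume) z‖ =
      ∫ z, ‖z‖ * ‖gradient ((⟨1, 2, one_pos, one_lt_two⟩ : ContDiffBump (0 : EuclideanSpace ℝ (Fin 3))).normed volume) z‖ := by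
  rw [eq_bumpRescale_of_shape φ h]
  exact integral_norm_mul_norm_gradient_normed_bumpRescale volume _ _

variable {F : Type*} [NormedAddCommGroup F]

/-- A function in `L²` of every ball about the origin is a.e.-strongly measurable (vector-valued). [folklore] -/
theorem aestronglyMeasurable_of_memLp_ball_vec {f : EuclideanSpace ℝ (Fin 3) → F}
    (h : ∀ r : ℝ, MemLp f 2 (volume.restrict (ball (0 : EuclideanSpace ℝ (Fin 3)) r))) : AEStronglyMeasurable f volume := by
  have hU : (⋃ n : ℕ, ball (0 : EuclideanSpace ℝ (Fin 3)) (n : ℝ)) = univ := iUnion_ball_nat 0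
  have h' : AEStronglyMeasurable f (volume.restrict (⋃ n : ℕ, ball (0 : EuclideanSpace ℝ (Fin 3)) (n : ℝ))) :=
    (aestronglyMeasurable_iUnion_iff).2 fun n => (h n).aestronglyMeasurable
  rwa [hU, Measure.restrict_univ] at h'

/-- `L²_loc ⊆ L¹_loc` (vector-valued). [folklore] -/
theorem locallyIntegrable_of_memLp_two_ball_vec {f : EuclideanSpace ℝ (Fin 3) → F}
    (h : ∀ r : ℝ, MemLp f 2 (volume.restrict (ball (0 : EuclideanSpace ℝ (Fin 3)) r))) : LocallyIntegrable f volume := by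
  refine WeakAxisym.locallyIntegrable_of_integrableOn_ball fun r => ?_
  haveI : IsFiniteMeasure ((volume : Measure (EuclideanSpace ℝ (Fin 3))).restrict (ball (0 : EuclideanSpace ℝ (Fin 3)) r)) :=
    isFiniteMeasure_restrict.2 measure_ball_lt_top.ne
  exact (h r).integrable one_le_two

end Tools

/-! ### The vector commutator -/

section Commutator

variable {W Θ S : EuclideanSpace ℝ (Fin 3) → EuclideanSpace ℝ (Fin 3)}
  {DW : EuclideanSpace ℝ (Fin 3) → EuclideanSpace ℝ (Fin 3) →L[ℝ] EuclideanSpace ℝ (Fin 3)} {c : ℝ}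

/-- `tr DW = c` a.e. ⇒ `φ̃ ⋆ (η·tr DW) = c·(φ̃ ⋆ η)` (convolution only sees the a.e. class). [folklore] -/
theorem convolution_mul_trace_eq_of_ae (φ : ContDiffBump (0 : EuclideanSpace ℝ (Fin 3))) (η : EuclideanSpace ℝ (Fin 3) → ℝ)
    (htr : ∀ᵐ y ∂(volume : Measure (EuclideanSpace ℝ (Fin 3))),
      LinearMap.trace ℝ (EuclideanSpace ℝ (Fin 3)) (DW y : EuclideanSpace ℝ (Fin 3) →ₗ[ℝ] EuclideanSpace ℝ (Fin 3)) = c) :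
    (φ.normed volume ⋆[lsmul ℝ ℝ, volume] fun y =>
        η y * LinearMap.trace ℝ (EuclideanSpace ℝ (Fin 3)) (DW y : EuclideanSpace ℝ (Fin 3) →ₗ[ℝ] EuclideanSpace ℝ (Fin 3))) =
      fun y => c * (φ.normed volume ⋆[lsmul ℝ ℝ, volume] η) y := by
  have hae : (fun y => η y * LinearMap.trace ℝ (EuclideanSpace ℝ (Fin 3))
      (DW y : EuclideanSpace ℝ (Fin 3) →ₗ[ℝ] EuclideanSpace ℝ (Fin 3))) =ᵐ[volume] fun y => c • η y := by
    filter_upwards [htr] with y hy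
    rw [hy, smul_eq_mul, mul_comm]
  rw [convolution_congr (lsmul ℝ ℝ) (Eventually.of_forall fun _ => rfl) hae, show (fun y => c • η y) = c • η from rfl,
    convolution_smul]
  funext y
  simp only [Pi.smul_apply, smul_eq_mul]

/-- **THE COMPONENTS OF THE VECTOR COMMUTATOR ARE THE DIPERNA–LIONS COMMUTATORS OF THE COMPONENTS**: with `Θₙ = φ̃ ⋆ Θ`, `Sₙ = φ̃ ⋆ S`,
`⟪DΘₙ(y)[W y] + cΘₙ(y) + Sₙ(y), e⟫ = ∫ ⟪Θ z, e⟫ Dφ̃(y−z)[W y − W z] dz + (φ̃ ⋆ (⟪Θ, e⟫·tr DW))(y)`.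
[folklore; DiPernaLions1989 §II.1] -/
theorem inner_commutatorVec_eq (hΘ : LocallyIntegrable Θ volume) (hWm : AEStronglyMeasurable W volume)
    (hΘW : LocallyIntegrable (fun y => ‖Θ y‖ * ‖W y‖) volume) (hS : LocallyIntegrable S volume)
    (htr : ∀ᵐ y ∂(volume : Measure (EuclideanSpace ℝ (Fin 3))),
      LinearMap.trace ℝ (EuclideanSpace ℝ (Fin 3)) (DW y : EuclideanSpace ℝ (Fin 3) →ₗ[ℝ] EuclideanSpace ℝ (Fin 3)) = c)
    (e : EuclideanSpace ℝ (Fin 3))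
    (heq : ∀ ψ : EuclideanSpace ℝ (Fin 3) → ℝ, IsTestFunctionOn (⊤ : Opens (EuclideanSpace ℝ (Fin 3))) ψ →
      ∫ y, ⟪Θ y, e⟫ * fderiv ℝ ψ y (W y) = ∫ y, ψ y * ⟪S y, e⟫)
    (φ : ContDiffBump (0 : EuclideanSpace ℝ (Fin 3))) (y : EuclideanSpace ℝ (Fin 3)) :
    ⟪fderiv ℝ (φ.normed volume ⋆[lsmul ℝ ℝ, volume] Θ) y (W y) + c • (φ.normed volume ⋆[lsmul ℝ ℝ, volume] Θ) y +
        (φ.normed volume ⋆[lsmul ℝ ℝ, volume] S) y, e⟫ =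
      (∫ z, ⟪Θ z, e⟫ * fderiv ℝ (φ.normed volume) (y - z) (W y - W z)) +
        (φ.normed volume ⋆[lsmul ℝ ℝ, volume] fun z =>
          ⟪Θ z, e⟫ * LinearMap.trace ℝ (EuclideanSpace ℝ (Fin 3)) (DW z : EuclideanSpace ℝ (Fin 3) →ₗ[ℝ] EuclideanSpace ℝ (Fin 3))) y := by
  have hφt : IsTestFunctionOn (⊤ : Opens (EuclideanSpace ℝ (Fin 3))) (φ.normed volume) :=
    ⟨φ.contDiff_normed, φ.hasCompactSupport_normed, by simp⟩
  rw [inner_add_left, inner_add_left, inner_fderiv_convolution_apply_transport_eq hΘ hWm hΘW hφt e heq y, inner_smul_left,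
    inner_convolution_eq hΘ φ.continuous_normed φ.hasCompactSupport_normed y e,
    inner_convolution_eq hS φ.continuous_normed φ.hasCompactSupport_normed y e, convolution_mul_trace_eq_of_ae φ _ htr,
    WeakAxisym.convolution_lsmul_eq_integral (η := fun z => ⟪S z, e⟫)]
  simp only [RCLike.conj_to_real]
  ring

variable {φ : ℕ → ContDiffBump (0 : EuclideanSpace ℝ (Fin 3))}

/-- **THE COMPONENTS OF THE VECTOR COMMUTATOR TEND TO ZERO IN `L¹_loc`** (DiPerna–Lions Lemma II.1, by name).
[folklore; DiPernaLions1989 Lemma II.1] -/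
theorem tendsto_setLIntegral_inner_commutatorVec
    (hΘ2 : ∀ r : ℝ, MemLp Θ 2 (volume.restrict (ball (0 : EuclideanSpace ℝ (Fin 3)) r)))
    (hW2 : ∀ r : ℝ, MemLp W 2 (volume.restrict (ball (0 : EuclideanSpace ℝ (Fin 3)) r)))
    (hDW : HasWeakFDerivOn (⊤ : Opens (EuclideanSpace ℝ (Fin 3))) volume W DW)
    (hDW2 : ∀ r : ℝ, MemLp DW 2 (volume.restrict (ball (0 : EuclideanSpace ℝ (Fin 3)) r)))
    (htr : ∀ᵐ y ∂(volume : Measure (EuclideanSpace ℝ (Fin 3))),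
      LinearMap.trace ℝ (EuclideanSpace ℝ (Fin 3)) (DW y : EuclideanSpace ℝ (Fin 3) →ₗ[ℝ] EuclideanSpace ℝ (Fin 3)) = c)
    (hS : LocallyIntegrable S volume) (e : EuclideanSpace ℝ (Fin 3))
    (heq : ∀ ψ : EuclideanSpace ℝ (Fin 3) → ℝ, IsTestFunctionOn (⊤ : Opens (EuclideanSpace ℝ (Fin 3))) ψ →
      ∫ y, ⟪Θ y, e⟫ * fderiv ℝ ψ y (W y) = ∫ y, ψ y * ⟪S y, e⟫)
    (hφ : Tendsto (fun n => (φ n).rOut) atTop (𝓝 0)) (hφ2 : ∀ n, (φ n).rOut = 2 * (φ n).rIn) (R : ℝ) :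
    Tendsto (fun n => ∫⁻ y in ball (0 : EuclideanSpace ℝ (Fin 3)) R,
      ‖⟪fderiv ℝ ((φ n).normed volume ⋆[lsmul ℝ ℝ, volume] Θ) y (W y) + c • ((φ n).normed volume ⋆[lsmul ℝ ℝ, volume] Θ) y +
        ((φ n).normed volume ⋆[lsmul ℝ ℝ, volume] S) y, e⟫‖ₑ) atTop (𝓝 0) := by
  have hΘ : LocallyIntegrable Θ volume := locallyIntegrable_of_memLp_two_ball_vec hΘ2
  have hWm : AEStronglyMeasurable W volume := aestronglyMeasurable_of_memLp_ball_vec hW2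
  have hΘW : LocallyIntegrable (fun y => ‖Θ y‖ * ‖W y‖) volume :=
    WeakAxisym.locallyIntegrable_mul_norm (fun r => (hΘ2 r).norm) hW2
  have hη2 : ∀ r : ℝ, MemLp (fun y => ⟪Θ y, e⟫) 2 (volume.restrict (ball (0 : EuclideanSpace ℝ (Fin 3)) r)) :=
    fun r => (hΘ2 r).inner_const e
  -- the DiPerna–Lions commutator lemma (tree form) for the component, with the constant moment of the fixed-shape family
  have hK : ∀ᶠ n in atTop, ∫ z, ‖z‖ * ‖gradient ((φ n).normed volume) z‖ ≤
      ∫ z, ‖z‖ * ‖gradient ((⟨1, 2, one_pos, one_lt_two⟩ : ContDiffBump (0 : EuclideanSpace ℝ (Fin 3))).normed volume) z‖ :=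
    Eventually.of_forall fun n => (integral_moment_eq_of_shape (φ n) (hφ2 n)).le
  have h := tendsto_setLIntegral_gradCommutator' (volume : Measure (EuclideanSpace ℝ (Fin 3))) hη2 hW2 hDW hDW2 hφ hK R
  refine h.congr' (Eventually.of_forall fun n => ?_)
  refine lintegral_congr fun y => ?_
  rw [inner_commutatorVec_eq hΘ hWm hΘW hS htr e heq (φ n) y,
    WeakAxisym.convolution_lsmul_eq_integral (φ := (φ n).normed volume)
      (η := fun z => ⟪Θ z, e⟫ * LinearMap.trace ℝ (EuclideanSpace ℝ (Fin 3)) (DW z : EuclideanSpace ℝ (Fin 3) →ₗ[ℝ] EuclideanSpace ℝ (Fin 3)))]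
  congr 2
  exact integral_congr_ae (Eventually.of_forall fun z => mul_assoc _ _ _)

/-- **THE VECTOR COMMUTATOR TENDS TO ZERO IN `L¹_loc`**: `∫_{B_R} ‖DΘₙ[W] + cΘₙ + Sₙ‖ → 0`. [folklore; DiPernaLions1989 §II.1] -/
theorem tendsto_setLIntegral_commutatorVec
    (hΘ2 : ∀ r : ℝ, MemLp Θ 2 (volume.restrict (ball (0 : EuclideanSpace ℝ (Fin 3)) r)))
    (hW2 : ∀ r : ℝ, MemLp W 2 (volume.restrict (ball (0 : EuclideanSpace ℝ (Fin 3)) r)))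
    (hDW : HasWeakFDerivOn (⊤ : Opens (EuclideanSpace ℝ (Fin 3))) volume W DW)
    (hDW2 : ∀ r : ℝ, MemLp DW 2 (volume.restrict (ball (0 : EuclideanSpace ℝ (Fin 3)) r)))
    (htr : ∀ᵐ y ∂(volume : Measure (EuclideanSpace ℝ (Fin 3))),
      LinearMap.trace ℝ (EuclideanSpace ℝ (Fin 3)) (DW y : EuclideanSpace ℝ (Fin 3) →ₗ[ℝ] EuclideanSpace ℝ (Fin 3)) = c)
    (hS : LocallyIntegrable S volume)
    (heq : ∀ ψ : EuclideanSpace ℝ (Fin 3) → ℝ, IsTestFunctionOn (⊤ : Opens (EuclideanSpace ℝ (Fin 3))) ψ →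
      ∀ e : EuclideanSpace ℝ (Fin 3), ∫ y, ⟪Θ y, e⟫ * fderiv ℝ ψ y (W y) = ∫ y, ψ y * ⟪S y, e⟫)
    (hφ : Tendsto (fun n => (φ n).rOut) atTop (𝓝 0)) (hφ2 : ∀ n, (φ n).rOut = 2 * (φ n).rIn) (R : ℝ) :
    Tendsto (fun n => ∫⁻ y in ball (0 : EuclideanSpace ℝ (Fin 3)) R,
      ‖fderiv ℝ ((φ n).normed volume ⋆[lsmul ℝ ℝ, volume] Θ) y (W y) + c • ((φ n).normed volume ⋆[lsmul ℝ ℝ, volume] Θ) y +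
        ((φ n).normed volume ⋆[lsmul ℝ ℝ, volume] S) y‖ₑ) atTop (𝓝 0) := by
  set b := EuclideanSpace.basisFun (Fin 3) ℝ with hb
  -- notation for the commutator
  obtain ⟨s, hs⟩ : ∃ s : ℕ → EuclideanSpace ℝ (Fin 3) → EuclideanSpace ℝ (Fin 3), s = fun n y =>
      fderiv ℝ ((φ n).normed volume ⋆[lsmul ℝ ℝ, volume] Θ) y (W y) + c • ((φ n).normed volume ⋆[lsmul ℝ ℝ, volume] Θ) y +
        ((φ n).normed volume ⋆[lsmul ℝ ℝ, volume] S) y := ⟨_, rfl⟩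
  have hcomp : ∀ i : Fin 3, Tendsto (fun n => ∫⁻ y in ball (0 : EuclideanSpace ℝ (Fin 3)) R, ‖⟪s n y, b i⟫‖ₑ) atTop (𝓝 0) := by
    intro i
    rw [hs]
    exact tendsto_setLIntegral_inner_commutatorVec hΘ2 hW2 hDW hDW2 htr hS (b i) (fun ψ hψ => heq ψ hψ (b i)) hφ hφ2 R
  -- measurability of the components
  have hΘ : LocallyIntegrable Θ volume := locallyIntegrable_of_memLp_two_ball_vec hΘ2
  have hWm : AEStronglyMeasurable W volume := aestronglyMeasurable_of_memLp_ball_vec hW2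
  have hsm : ∀ n, AEStronglyMeasurable (s n) volume := by
    intro n
    rw [hs]
    have hφt : IsTestFunctionOn (⊤ : Opens (EuclideanSpace ℝ (Fin 3))) ((φ n).normed volume) :=
      ⟨(φ n).contDiff_normed, (φ n).hasCompactSupport_normed, by simp⟩
    have h1c : Continuous (fderiv ℝ ((φ n).normed volume ⋆[lsmul ℝ ℝ, volume] Θ)) :=
      (contDiff_convolution_of_test hΘ hφt (n := 1)).continuous_fderiv one_ne_zero
    have h1 : AEStronglyMeasurable (fun y => fderiv ℝ ((φ n).normed volume ⋆[lsmul ℝ ℝ, volume] Θ) y (W y)) volume :=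
      Continuous.comp_aestronglyMeasurable₂
        (g := fun (L : EuclideanSpace ℝ (Fin 3) →L[ℝ] EuclideanSpace ℝ (Fin 3)) (v : EuclideanSpace ℝ (Fin 3)) => L v)
        (isBoundedBilinearMap_apply (𝕜 := ℝ) (E := EuclideanSpace ℝ (Fin 3)) (F := EuclideanSpace ℝ (Fin 3))).continuous
        h1c.aestronglyMeasurable hWm
    have h2 : Continuous fun y => c • ((φ n).normed volume ⋆[lsmul ℝ ℝ, volume] Θ) y :=
      ((φ n).hasCompactSupport_normed.continuous_convolution_left _ (φ n).continuous_normed hΘ).const_smul c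
    have h3 : Continuous ((φ n).normed volume ⋆[lsmul ℝ ℝ, volume] S) :=
      (φ n).hasCompactSupport_normed.continuous_convolution_left _ (φ n).continuous_normed hS
    exact (h1.add h2.aestronglyMeasurable).add h3.aestronglyMeasurable
  -- `‖s‖ ≤ Σᵢ |⟪s, bᵢ⟫|` and the sum of the three limits
  have hsum : Tendsto (fun n => ∑ i : Fin 3, ∫⁻ y in ball (0 : EuclideanSpace ℝ (Fin 3)) R, ‖⟪s n y, b i⟫‖ₑ) atTop (𝓝 0) := by
    have h := tendsto_finsetSum (Finset.univ : Finset (Fin 3)) fun i _ => hcomp i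
    rwa [Finset.sum_const_zero] at h
  rw [show (fun n => ∫⁻ y in ball (0 : EuclideanSpace ℝ (Fin 3)) R,
      ‖fderiv ℝ ((φ n).normed volume ⋆[lsmul ℝ ℝ, volume] Θ) y (W y) + c • ((φ n).normed volume ⋆[lsmul ℝ ℝ, volume] Θ) y +
        ((φ n).normed volume ⋆[lsmul ℝ ℝ, volume] S) y‖ₑ) = fun n => ∫⁻ y in ball (0 : EuclideanSpace ℝ (Fin 3)) R, ‖s n y‖ₑ by
    rw [hs]]
  refine tendsto_of_tendsto_of_tendsto_of_le_of_le' tendsto_const_nhds hsum (Eventually.of_forall fun n => bot_le)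
    (Eventually.of_forall fun n => ?_)
  calc ∫⁻ y in ball (0 : EuclideanSpace ℝ (Fin 3)) R, ‖s n y‖ₑ
      ≤ ∫⁻ y in ball (0 : EuclideanSpace ℝ (Fin 3)) R, ∑ i : Fin 3, ‖⟪s n y, b i⟫‖ₑ :=
        lintegral_mono fun y => enorm_le_sum_enorm_inner_basisFun (s n y)
    _ = ∑ i : Fin 3, ∫⁻ y in ball (0 : EuclideanSpace ℝ (Fin 3)) R, ‖⟪s n y, b i⟫‖ₑ :=
        lintegral_finsetSum' _ fun i _ => ((hsm n).inner aestronglyMeasurable_const).enorm.restrict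

end Commutator

end Summit.NavierStokesRegularity.NavierStokesRegularity.Theorems.PowerGaugeEulerLiouville.WeakEulerian

end
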